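import Summits.RiemannHypothesis.RiemannHypothesis.Theorems.WeilFormatCPolyWindowArch
import Summits.RiemannHypothesis.RiemannHypothesis.Theorems.WeilFormatCEntryArchIntegrals
import Literature.Analysis.SpecialFunctions.PolygammaSeries
import HarnessLib

/-!
# Format C, design C∞ (L2–IX): the window constants `W_p(a)` through `ψ^{(p)}(¼)` — the polygamma light-table form

Route context: Fourier–Galerkin / Schur-complement certificates of Weil positivity on a window ("format C";
cell memo `run/shared/lean/pub/rh-explicit/rh-explicit-weil-10/FORMATC-DESIGN.md` §1.5, §9.12.10; supporting
stmt-RiemannHypothesis-0098; seat rh-explicit-weil-10).  The archimedean blocks of the polynomial-window entries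
(`WeilFormatCPolyWindowArchExpansion.lean`, `…MixedArch.lean`) are finite combinations of the window constants
`W_p(a) = ∫_{(0,2a]} ρ(t) t^p dt` (`p ≥ 1`), which `WeilFormatCPolyWindowArch.lean` writes as the node series
`Σ_k [p!/l_k^{p+1} − e^{−2a l_k} Σ_{m≤p} p^{(m)}(2a)^{p−m}/l_k^{m+1}]`, `l_k = 2k + ½`.  Here the main part is summed in
closed form through the tree's polygamma series (`PolygammaSeries.hasSum_iteratedDeriv_digamma`:
`ψ^{(p)}(w) = (−1)^{p+1} p! Σ_j (w+j)^{−(p+1)}`), giving the shape in which the (E) side encloses them — ONE special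
value `ψ^{(p)}(¼)` per degree plus a rapidly convergent (ratio `e^{−4a}`) correction:

* `setIntegral_exp_neg_mul_pow_nonneg/le` — `0 ≤ ∫_{(0,T]} e^{−lt}t^p ≤ p!/l^{p+1}`;
* `hasSum_factorial_div_digammaNode_pow` — `Σ_k p!/l_k^{p+1} = (−1)^{p+1} Re ψ^{(p)}(¼)/2^{p+1}` (`p ≥ 1`);
* `nodeCorrection_le` — the uniform bound `Σ_{m≤p} p^{(m)}(2a)^{p−m}/l_k^{m+1} ≤ Σ_{m≤p} p^{(m)}(2a)^{p−m}2^{m+1}`;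
* **`setIntegral_weilArchDensity_mul_pow_eq_polygamma`** —
  `W_p(a) = (−1)^{p+1} Re ψ^{(p)}(¼)/2^{p+1} − Σ_k e^{−2a l_k} Σ_{m≤p} p^{(m)}(2a)^{p−m}/l_k^{m+1}` (`p ≥ 1`, `a > 0`).

Pure analysis bookkeeping; standard axioms; no RH claim.
-/

set_option autoImplicit false
-- `Summit.RiemannHypothesis.RiemannHypothesis.…` is the layout-mandated namespace (summit = problem name).
set_option linter.dupNamespace false

noncomputable section

open Complex Filter Set MeasureTheory
open scoped Real Topology

namespace Summit.RiemannHypothesis.RiemannHypothesis.Theorems.WeilFormatC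

open Literature.NumberTheory.LFunctions Literature.Analysis.SpecialFunctions

variable {a : ℝ}

/-! ## Bounds for the node integrals -/

/-- `0 ≤ ∫_{(0,T]} e^{−lt} t^p dt`. -/
theorem setIntegral_exp_neg_mul_pow_nonneg (l T : ℝ) (p : ℕ) :
    0 ≤ ∫ t in Ioc 0 T, Real.exp (-(l * t)) * t ^ p :=
  setIntegral_nonneg measurableSet_Ioc fun _ ht ↦ mul_nonneg (Real.exp_pos _).le (pow_nonneg ht.1.le _)

/-- The correction sum `Σ_{m≤p} p^{(m)} T^{p−m}/l^{m+1}` is non-negative (`l > 0`, `T ≥ 0`). -/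
theorem nodeCorrection_nonneg {l T : ℝ} (hl : 0 < l) (hT : 0 ≤ T) (p : ℕ) :
    0 ≤ ∑ m ∈ Finset.range (p + 1), (p.descFactorial m : ℝ) * T ^ (p - m) / l ^ (m + 1) :=
  Finset.sum_nonneg fun _ _ ↦ by positivity

/-- `∫_{(0,T]} e^{−lt} t^p dt ≤ p!/l^{p+1}` (`l > 0`, `T ≥ 0`; the complete Gamma integral). -/
theorem setIntegral_exp_neg_mul_pow_le {l T : ℝ} (hl : 0 < l) (hT : 0 ≤ T) (p : ℕ) :
    ∫ t in Ioc 0 T, Real.exp (-(l * t)) * t ^ p ≤ (p.factorial : ℝ) / l ^ (p + 1) := by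
  rw [setIntegral_exp_neg_mul_pow_eq hl.ne' hT]
  exact sub_le_self _ (mul_nonneg (Real.exp_pos _).le (nodeCorrection_nonneg hl hT p))

/-- **Uniform bound for the correction sums at the nodes** (`l_k ≥ ½`, `a ≥ 0`):
`Σ_{m≤p} p^{(m)}(2a)^{p−m}/l_k^{m+1} ≤ Σ_{m≤p} p^{(m)}(2a)^{p−m} 2^{m+1}`. -/
theorem nodeCorrection_le (ha : 0 ≤ a) (p k : ℕ) :
    ∑ m ∈ Finset.range (p + 1), (p.descFactorial m : ℝ) * (2 * a) ^ (p - m) / digammaNode k ^ (m + 1) ≤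
      ∑ m ∈ Finset.range (p + 1), (p.descFactorial m : ℝ) * (2 * a) ^ (p - m) * 2 ^ (m + 1) := by
  refine Finset.sum_le_sum fun m _ ↦ ?_
  have hl := digammaNode_pos k
  have h2l : 1 ≤ 2 * digammaNode k := by linarith [one_half_le_digammaNode k]
  rw [div_le_iff₀ (pow_pos hl _), mul_assoc, mul_assoc, ← mul_pow]
  exact mul_le_mul_of_nonneg_left (le_mul_of_one_le_right (by positivity) (one_le_pow₀ h2l)) (by positivity)

/-! ## The main part through `ψ^{(p)}(¼)` -/

/-- **`Σ_k p!/l_k^{p+1} = (−1)^{p+1} Re ψ^{(p)}(¼) / 2^{p+1}`** for `p ≥ 1` (`l_k = 2k + ½ = 2(k + ¼)`; the polygamma series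
`ψ^{(p)}(¼) = (−1)^{p+1} p! Σ_k (k + ¼)^{−(p+1)}`). -/
theorem hasSum_factorial_div_digammaNode_pow {p : ℕ} (hp : 1 ≤ p) :
    HasSum (fun k : ℕ ↦ (p.factorial : ℝ) / digammaNode k ^ (p + 1))
      ((-1) ^ (p + 1) * (iteratedDeriv p Complex.digamma (1 / 4)).re / 2 ^ (p + 1)) := by
  have hw : 0 < ((1 / 4 : ℂ)).re := by norm_num
  have h := Complex.hasSum_re (Literature.Analysis.SpecialFunctions.Complex.hasSum_iteratedDeriv_digamma hw hp)
  have hterm : ∀ j : ℕ, (((-1 : ℂ) ^ (p + 1) * (p.factorial : ℂ) * (((1 / 4 : ℂ) + j) ^ (p + 1))⁻¹)).re =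
      (-1) ^ (p + 1) * (p.factorial : ℝ) / ((1 / 4 : ℝ) + j) ^ (p + 1) := by
    intro j
    have e : ((-1 : ℂ) ^ (p + 1) * (p.factorial : ℂ) * (((1 / 4 : ℂ) + j) ^ (p + 1))⁻¹) =
        (((-1) ^ (p + 1) * (p.factorial : ℝ) / ((1 / 4 : ℝ) + j) ^ (p + 1) : ℝ) : ℂ) := by
      push_cast
      ring
    rw [e, Complex.ofReal_re]
  simp_rw [hterm] at h
  have h2 := h.mul_left ((-1 : ℝ) ^ (p + 1) / 2 ^ (p + 1))
  have hsq : ((-1 : ℝ) ^ (p + 1)) * ((-1) ^ (p + 1)) = 1 := by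
    rw [← mul_pow]; norm_num
  have h3 : HasSum (fun k : ℕ ↦ (p.factorial : ℝ) / digammaNode k ^ (p + 1))
      ((-1 : ℝ) ^ (p + 1) / 2 ^ (p + 1) * (iteratedDeriv p Complex.digamma (1 / 4)).re) := by
    refine h2.congr_fun fun k ↦ ?_
    have hq : (1 / 4 : ℝ) + k ≠ 0 := by positivity
    have hnode : digammaNode k = 2 * ((1 / 4 : ℝ) + k) := by rw [digammaNode]; ring
    calc (p.factorial : ℝ) / digammaNode k ^ (p + 1)
        = ((-1 : ℝ) ^ (p + 1) * (-1) ^ (p + 1)) * (p.factorial : ℝ) / (2 ^ (p + 1) * ((1 / 4 : ℝ) + k) ^ (p + 1)) := by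
          rw [hsq, one_mul, hnode, mul_pow]
      _ = (-1 : ℝ) ^ (p + 1) / 2 ^ (p + 1) * ((-1) ^ (p + 1) * (p.factorial : ℝ) / ((1 / 4 : ℝ) + k) ^ (p + 1)) := by
          field_simp
  have e : (-1 : ℝ) ^ (p + 1) / 2 ^ (p + 1) * (iteratedDeriv p Complex.digamma (1 / 4)).re =
      (-1) ^ (p + 1) * (iteratedDeriv p Complex.digamma (1 / 4)).re / 2 ^ (p + 1) := by ring
  rw [e] at h3
  exact h3

/-! ## The window constants in polygamma form -/

/-- **The window constants through `ψ^{(p)}(¼)`** (`a > 0`, `p ≥ 1`):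
`W_p(a) = ∫_{(0,2a]} ρ(t) t^p dt = (−1)^{p+1} Re ψ^{(p)}(¼)/2^{p+1} − Σ_k e^{−2a l_k} Σ_{m≤p} p^{(m)}(2a)^{p−m}/l_k^{m+1}`,
the correction series converging at the geometric rate `e^{−4a}` with terms bounded by `nodeCorrection_le`. -/
theorem setIntegral_weilArchDensity_mul_pow_eq_polygamma (ha : 0 < a) {p : ℕ} (hp : 1 ≤ p) :
    ∫ t in Ioc 0 (2 * a), weilArchDensity t * t ^ p =
      (-1) ^ (p + 1) * (iteratedDeriv p Complex.digamma (1 / 4)).re / 2 ^ (p + 1) -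
        ∑' k : ℕ, Real.exp (-(2 * a * digammaNode k)) *
          ∑ m ∈ Finset.range (p + 1), (p.descFactorial m : ℝ) * (2 * a) ^ (p - m) / digammaNode k ^ (m + 1) := by
  obtain ⟨q, rfl⟩ : ∃ q, p = q + 1 := ⟨p - 1, by omega⟩
  have hT : (0 : ℝ) ≤ 2 * a := by positivity
  have h1 := hasSum_setIntegral_weilArchDensity_mul_pow_succ ha q
  have hterm : ∀ k : ℕ, ∫ t in Ioc 0 (2 * a), Real.exp (-(digammaNode k * t)) * t ^ (q + 1) =
      ((q + 1).factorial : ℝ) / digammaNode k ^ (q + 1 + 1) -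
        Real.exp (-(2 * a * digammaNode k)) *
          ∑ m ∈ Finset.range (q + 1 + 1), ((q + 1).descFactorial m : ℝ) * (2 * a) ^ (q + 1 - m) /
            digammaNode k ^ (m + 1) := by
    intro k
    rw [setIntegral_exp_neg_mul_pow_eq (digammaNode_pos k).ne' hT (q + 1),
      show digammaNode k * (2 * a) = 2 * a * digammaNode k by ring]
  simp_rw [hterm] at h1
  have h2 := hasSum_factorial_div_digammaNode_pow hp
  have h3 := (summable_exp_neg_mul_of_bounded ha
    (b := fun k ↦ ∑ m ∈ Finset.range (q + 1 + 1), ((q + 1).descFactorial m : ℝ) * (2 * a) ^ (q + 1 - m) /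
      digammaNode k ^ (m + 1))
    (C := ∑ m ∈ Finset.range (q + 1 + 1), ((q + 1).descFactorial m : ℝ) * (2 * a) ^ (q + 1 - m) * 2 ^ (m + 1))
    (fun k ↦ by
      rw [abs_of_nonneg (nodeCorrection_nonneg (digammaNode_pos k) hT (q + 1))]
      exact nodeCorrection_le ha.le (q + 1) k)).hasSum
  exact h1.unique (h2.sub h3)

end Summit.RiemannHypothesis.RiemannHypothesis.Theorems.WeilFormatC

end
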